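import Summits.BirchSwinnertonDyer.Rank1Residual.Additive.GordRatMainConjLowerBoundOdd
import Summits.BirchSwinnertonDyer.Rank1Residual.Additive.CycLowerInputsBridge
import Summits.BirchSwinnertonDyer.Rank1Residual.Additive.SemistableTwistTowerThree
import HarnessLib

/-!
# The (G)-ordinary cell, defect 2, EVERY odd `p` (`p = 3` included): the LOWER half from the rational
# branch main conjecture + ONE `μ`-certificate + the typed EXACT leading term, and `BSD(E,p)` with the
# certificate-free Kato / Wuthrich upper halves (cell `b2b-bsdres`, team n1011, seat n1011-p06, OWNERS
# row T-N10R, phase 6 — the Gord3 rows of N11)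

HONEST FRAMING (cell `b2b-bsdres`, run/shared/lean/b2b/bsd-rank1-residual/, verbatim in every
file): the goal of the cell is to DELETE the COMBINATION-SHAPED residual classes of the
Birch–Swinnerton-Dyer formula for ALL analytic-rank `≤ 1` elliptic curves over `ℚ` — "full BSD
formula for every rank `≤ 1` curve in class `C`" assembled STRICTLY from published theorems — so
that the rank-`≤ 1` remainder becomes exactly the CONSTRUCTION-SHAPED classes, which are TYPED
(missing-input `Prop`s), NOT attempted. This is not "finishing BSD". Team n1011 (§I items N10 / N11):
research routes; prove what is provable now; no claim beyond the stated classes; X4♯(G-ord) /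
X3♯(G-ord) stay CONSTRUCTION-SHAPED; labels / census / located gap UNCHANGED; nothing is booked.
Theorems only; no definition, no named fact.

## What and why

Phases 1–2 gave, on X4♯(G-ord) ∩ `I₀*`, `CycLowerLeadingTermAt W p` from the typed RATIONAL branch
main conjecture of the good-ordinary twist plus one unit coefficient, and the Miller-currency LOWER
half through Delbourgo 2002 — which needs `p ≥ 5`, `E` non-CM and a NON-ANOMALOUS twist. n1011-p18's
`CycLeadingTermDvd.lean` offers a second Miller-currency end with NONE of these three restrictions:
`ClassX4Gord.missingLowerBoundAt_rankZero_of_cycLeadingTermDvd_of_exact`, whose extra input is the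
typed EXACT rank-`0` leading term `ExactLeadingTermAt W p` (Delbourgo 1998 Prop. 4 with the
`H¹`-factor of `p`-part `1`; a THEOREM on (M), `exactLeadingTermAt_of_potMult`; on (G)-ordinary the
object of n1011-p16/p18's `Delbourgo2002.mainTheorem_three` bridge at `p = 3`). Composing through the
equivalence `CycLowerLeadingTermAt ⟺ CycLeadingTermDvdAt` (`CycLowerInputsBridge.lean`):

* `ClassX4Gord.missingLowerBoundAt_rankZero_of_ratCharEq[Odd]_of_unitCoeff_of_exact` — EVERY odd `p`
  of the stated parity, `p = 3` INCLUDED in the odd case (the Gord3 = (G-ord, `e = 2`)@3 rows of N11),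
  no non-CM / anomalous binder;
* `ClassX4Gord.bsdp_rankZero_of_ratCharEq[Odd]_of_unitCoeff_of_exact_of_surj` — `BSD(E,p)` with the
  certificate-free upper half `ClassX4Gord.missingUpperBoundAt_rankZero_of_katoComponent_of_surj`
  (n1011-p14's `3`-adic tower from surj alone; Kato 2004 Thm. 17.4 (3) component reading `hK`);
  `ClassX4Gord.bsdp_three_of_ratCharEqOdd_of_unitCoeff_of_exact_of_surj` — the `p = 3` reading;
* the X3♯(G-ord) ∩ `I₀*` twins with Wuthrich's reducible upper half
  (`ClassX3Gord.missingUpperBoundAt_rankZero_of_wuthrichHalf`, any odd `p`, NO image hypothesis).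

Located gap on these rows, in kernel form: {rational `ω^{(p−1)/2}`-branch main conjecture of `E♭`
(`ChiBranchRatCharEq[Odd]At`, no printed Eisenstein half), the certificate (per-pair EVIDENCE,
`cells/n1011/PREDICTIONS-Q6.md`), `ExactLeadingTermAt W p` (typed)}. Nothing booked.

References: Delbourgo, Compositio Math. 113 (1998) Prop. 4, Main Conjecture p. 151 [Delbourgo1998];
Kato, Astérisque 295 (2004) Thm. 17.4 (3) [Kato2004Asterisque]; Wuthrich, Doc. Math. 19 (2014) Thm. 16
[Wuthrich2014]; Burungale–Castella–Skinner, IMRN 2025 Thm. 1.1.2 (a) [BurungaleCastellaSkinner2025];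
Mazur–Tate–Teitelbaum, Invent. Math. 84 (1986) §I.14 [MazurTateTeitelbaum1986Invent]; Pal, Proc. AMS
(2012) Thm. 3.2 [Pal2012]; Miller, LMS J. Comput. Math. 14 (2011) Def. 1.1 [Miller2011LMS].
-/

noncomputable section

open scoped Classical MatrixGroups ModularForm NumberField

open CongruenceSubgroup WeierstrassCurve NumberField Literature.NumberTheory.EllipticCurves
  Literature.NumberTheory.EllipticCurves.ModularForms
  Literature.NumberTheory.EllipticCurves.Rank1Residual
  Literature.NumberTheory.EllipticCurves.Rank1Residual.Typed
  IsDedekindDomain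

namespace Summit.BirchSwinnertonDyer.Rank1Residual.Additive

variable {W : WeierstrassCurve ℚ} [W.IsElliptic] [W.IsGloballyMinimal] {p : ℕ} [hp : Fact p.Prime]

/-! ### §1 X4♯(G-ord) ∩ `I₀*`: the lower half from rational MC + certificate + exact leading term -/

/-- **X4♯(G-ord) ∩ `I₀*`, `p ≡ 1 (mod 4)`, `r_an = 0`: the LOWER half from the rational branch main
conjecture, the `μ`-certificate and the typed exact leading term `ExactLeadingTermAt W p`** — through
`CycLowerLeadingTermAt` (phase 1), the bridge to `CycLeadingTermDvdAt`, and n1011-p18's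
`ClassX4Gord.missingLowerBoundAt_rankZero_of_cycLeadingTermDvd_of_exact`. No `p ≥ 5` / non-CM /
non-anomalous binder. [cite: Delbourgo1998, Prop. 4 (p. 144), Main Conjecture (p. 151) (shapes)] -/
theorem ClassX4Gord.missingLowerBoundAt_rankZero_of_ratCharEq_of_unitCoeff_of_exact
    (hPal : Pal2012.thm32_sqrt_mul_realPeriodRat_twist_eq_of_prime_one_mod_four)
    (hGZK : rank_eq_analyticRank_of_analyticRank_le_one) (hmod : hasEntireLFunction_rat)
    (hmodD : nonempty_modularParametrizationData)
    (hX : ClassX4Gord W p) (he : semistabilityIndex W p = 2) (hp4 : p % 4 = 1)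
    (hr : W.analyticRank = 0) (hMC : ChiBranchRatCharEqAt W p)
    (hcert : ∀ (V : WeierstrassCurve ℚ) [V.IsElliptic] [V.IsGloballyMinimal] (C : VariableChange ℚ),
      GoodOrd V p → C • V.quadraticTwist (p : ℚ) = W →
      ∀ {N : ℕ} [NeZero N] (f : CuspForm (Gamma0 N) 2), IsNewformOf V f →
      ∀ ϖ : ℚ, (ϖ : ℝ) * V.realPeriodRat = plusPeriod f →
      ∃ n : ℕ, ‖PowerSeries.coeff n
        (PowerSeries.C (ϖ : ℚ_[p]) * padicLFunctionBranch f (unitRoot V p : ℚ_[p]) (p / 2))‖ = 1)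
    (hEx : ExactLeadingTermAt W p) : MissingLowerBoundAt W p :=
  ClassX4Gord.missingLowerBoundAt_rankZero_of_cycLeadingTermDvd_of_exact hGZK hmod hX hr
    (cycLeadingTermDvdAt_of_cycLowerLeadingTermAt
      (ClassX4Gord.cycLowerLeadingTermAt_of_ratCharEq_of_unitCoeff hPal hmod hmodD hX he hp4 hMC hcert))
    hEx

/-- **X4♯(G-ord) ∩ `I₀*`, `p ≡ 3 (mod 4)` (`p = 3` INCLUDED), `r_an = 0`: the LOWER half from the
rational ODD branch main conjecture, the certificate and `ExactLeadingTermAt W p`.**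
[cite: Delbourgo1998, Prop. 4 (p. 144), Main Conjecture (p. 151) (shapes)] -/
theorem ClassX4Gord.missingLowerBoundAt_rankZero_of_ratCharEqOdd_of_unitCoeff_of_exact
    (hGZK : rank_eq_analyticRank_of_analyticRank_le_one) (hmod : hasEntireLFunction_rat)
    (hmodD : nonempty_modularParametrizationData)
    (hX : ClassX4Gord W p) (he : semistabilityIndex W p = 2) (hp4 : p % 4 = 3)
    (hr : W.analyticRank = 0) (hMC : ChiBranchRatCharEqOddAt W p)
    (hcert : ∀ (V : WeierstrassCurve ℚ) [V.IsElliptic] [V.IsGloballyMinimal] (C : VariableChange ℚ),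
      GoodOrd V p → C • V.quadraticTwist (-(p : ℚ)) = W →
      ∀ {N : ℕ} [NeZero N] (f : CuspForm (Gamma0 N) 2), IsNewformOf V f →
      ∀ ϖ : ℚ, (ϖ : ℝ) * V.imaginaryPeriodRat = minusPeriod f →
      ∃ n : ℕ, ‖PowerSeries.coeff n
        (PowerSeries.C (ϖ : ℚ_[p]) * padicLFunctionMinusBranch f (unitRoot V p : ℚ_[p]) (p / 2))‖ = 1)
    (hEx : ExactLeadingTermAt W p) : MissingLowerBoundAt W p :=
  ClassX4Gord.missingLowerBoundAt_rankZero_of_cycLeadingTermDvd_of_exact hGZK hmod hX hr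
    (cycLeadingTermDvdAt_of_cycLowerLeadingTermAt
      (ClassX4Gord.cycLowerLeadingTermAt_of_ratCharEqOdd_of_unitCoeff hmod hmodD hX he hp4 hMC hcert))
    hEx

/-- **X4♯(G-ord) ∩ `I₀*` ∩ surj(p), `p ≡ 1 (mod 4)`, `r_an = 0`: `BSD(E,p)` from the rational branch
main conjecture + certificate + `ExactLeadingTermAt W p`, the UPPER half being the certificate-free
Kato component reading** (`ClassX4Gord.missingUpperBoundAt_rankZero_of_katoComponent_of_surj`:
Kato 2004 Thm. 17.4 (3) on the `ω^{(p−1)/2}`-component `hK`, Delbourgo 1998 Prop. 4 `hDel`; tower from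
surj alone, n1011-p14). Nothing booked. [cite: Kato2004Asterisque, Thm. 17.4 (3) (p. 273)]
[cite: Delbourgo1998, Prop. 4 (p. 144)] [cite: Miller2011LMS, Def. 1.1] -/
theorem ClassX4Gord.bsdp_rankZero_of_ratCharEq_of_unitCoeff_of_exact_of_surj
    (hK : Kato2004.charIdeal_dvd_padicLFunctionBranch_component_of_surjective)
    (hDel : Delbourgo1998.prop4_rankZero_pow_dvd_constantCoeff)
    (hPal : Pal2012.thm32_sqrt_mul_realPeriodRat_twist_eq_of_prime_one_mod_four)
    (hGZK : rank_eq_analyticRank_of_analyticRank_le_one) (hmod : hasEntireLFunction_rat)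
    (hmodD : nonempty_modularParametrizationData)
    (hX : ClassX4Gord W p) (he : semistabilityIndex W p = 2) (hp4 : p % 4 = 1)
    (hr : W.analyticRank = 0) (hsurj : Surj W p) (hMC : ChiBranchRatCharEqAt W p)
    (hcert : ∀ (V : WeierstrassCurve ℚ) [V.IsElliptic] [V.IsGloballyMinimal] (C : VariableChange ℚ),
      GoodOrd V p → C • V.quadraticTwist (p : ℚ) = W →
      ∀ {N : ℕ} [NeZero N] (f : CuspForm (Gamma0 N) 2), IsNewformOf V f →
      ∀ ϖ : ℚ, (ϖ : ℝ) * V.realPeriodRat = plusPeriod f →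
      ∃ n : ℕ, ‖PowerSeries.coeff n
        (PowerSeries.C (ϖ : ℚ_[p]) * padicLFunctionBranch f (unitRoot V p : ℚ_[p]) (p / 2))‖ = 1)
    (hEx : ExactLeadingTermAt W p) : BSDp W p :=
  bsdp_of_missingPPartAt W p hGZK (by rw [hr]; exact zero_le_one)
    (missingPPartAt_of_lower_of_upper W p
      (ClassX4Gord.missingLowerBoundAt_rankZero_of_ratCharEq_of_unitCoeff_of_exact hPal hGZK hmod hmodD
        hX he hp4 hr hMC hcert hEx)
      (ClassX4Gord.missingUpperBoundAt_rankZero_of_katoComponent_of_surj hK hDel hGZK hmod hmodD hX he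
        hr hsurj))

/-- **X4♯(G-ord) ∩ `I₀*` ∩ surj(p), `p ≡ 3 (mod 4)` (`p = 3` INCLUDED), `r_an = 0`: `BSD(E,p)` from
the rational ODD branch main conjecture + certificate + `ExactLeadingTermAt W p` and the
certificate-free Kato component upper half.** Nothing booked. [cite: Kato2004Asterisque, Thm. 17.4 (3) (p. 273)]
[cite: Delbourgo1998, Prop. 4 (p. 144)] [cite: Miller2011LMS, Def. 1.1] -/
theorem ClassX4Gord.bsdp_rankZero_of_ratCharEqOdd_of_unitCoeff_of_exact_of_surj
    (hK : Kato2004.charIdeal_dvd_padicLFunctionBranch_component_of_surjective)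
    (hDel : Delbourgo1998.prop4_rankZero_pow_dvd_constantCoeff)
    (hGZK : rank_eq_analyticRank_of_analyticRank_le_one) (hmod : hasEntireLFunction_rat)
    (hmodD : nonempty_modularParametrizationData)
    (hX : ClassX4Gord W p) (he : semistabilityIndex W p = 2) (hp4 : p % 4 = 3)
    (hr : W.analyticRank = 0) (hsurj : Surj W p) (hMC : ChiBranchRatCharEqOddAt W p)
    (hcert : ∀ (V : WeierstrassCurve ℚ) [V.IsElliptic] [V.IsGloballyMinimal] (C : VariableChange ℚ),
      GoodOrd V p → C • V.quadraticTwist (-(p : ℚ)) = W →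
      ∀ {N : ℕ} [NeZero N] (f : CuspForm (Gamma0 N) 2), IsNewformOf V f →
      ∀ ϖ : ℚ, (ϖ : ℝ) * V.imaginaryPeriodRat = minusPeriod f →
      ∃ n : ℕ, ‖PowerSeries.coeff n
        (PowerSeries.C (ϖ : ℚ_[p]) * padicLFunctionMinusBranch f (unitRoot V p : ℚ_[p]) (p / 2))‖ = 1)
    (hEx : ExactLeadingTermAt W p) : BSDp W p :=
  bsdp_of_missingPPartAt W p hGZK (by rw [hr]; exact zero_le_one)
    (missingPPartAt_of_lower_of_upper W p
      (ClassX4Gord.missingLowerBoundAt_rankZero_of_ratCharEqOdd_of_unitCoeff_of_exact hGZK hmod hmodD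
        hX he hp4 hr hMC hcert hEx)
      (ClassX4Gord.missingUpperBoundAt_rankZero_of_katoComponent_of_surj hK hDel hGZK hmod hmodD hX he
        hr hsurj))

/-- **The Gord3 rows of N11 — X4♯(G-ord) ∩ `I₀*` ∩ surj(3) at `p = 3`, `r_an = 0`: `BSD(E,3)`** ⟸
rational odd-branch main conjecture of the twist (`ChiBranchRatCharEqOddAt W 3`) + ONE unit
coefficient + `ExactLeadingTermAt W 3` + the printed, certificate-free upper half at `3`. Nothing booked;
X4♯(G-ord) stays CONSTRUCTION-SHAPED. [cite: Kato2004Asterisque, Thm. 17.4 (3) (p. 273)]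
[cite: Delbourgo1998, Prop. 4 (p. 144)] [cite: Miller2011LMS, Def. 1.1] -/
theorem ClassX4Gord.bsdp_three_of_ratCharEqOdd_of_unitCoeff_of_exact_of_surj [Fact (Nat.Prime 3)]
    (hK : Kato2004.charIdeal_dvd_padicLFunctionBranch_component_of_surjective)
    (hDel : Delbourgo1998.prop4_rankZero_pow_dvd_constantCoeff)
    (hGZK : rank_eq_analyticRank_of_analyticRank_le_one) (hmod : hasEntireLFunction_rat)
    (hmodD : nonempty_modularParametrizationData)
    (hX : ClassX4Gord W 3) (hr : W.analyticRank = 0) (hsurj : Surj W 3) (hMC : ChiBranchRatCharEqOddAt W 3)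
    (hcert : ∀ (V : WeierstrassCurve ℚ) [V.IsElliptic] [V.IsGloballyMinimal] (C : VariableChange ℚ),
      GoodOrd V 3 → C • V.quadraticTwist (-(3 : ℚ)) = W →
      ∀ {N : ℕ} [NeZero N] (f : CuspForm (Gamma0 N) 2), IsNewformOf V f →
      ∀ ϖ : ℚ, (ϖ : ℝ) * V.imaginaryPeriodRat = minusPeriod f →
      ∃ n : ℕ, ‖PowerSeries.coeff n
        (PowerSeries.C (ϖ : ℚ_[3]) * padicLFunctionMinusBranch f (unitRoot V 3 : ℚ_[3]) (3 / 2))‖ = 1)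
    (hEx : ExactLeadingTermAt W 3) : BSDp W 3 :=
  ClassX4Gord.bsdp_rankZero_of_ratCharEqOdd_of_unitCoeff_of_exact_of_surj hK hDel hGZK hmod hmodD hX
    (semistabilityIndex_eq_two_of_typeG_three W hX.typeGOrd.typeG hX.addv.2) (by norm_num) hr hsurj hMC
    (by exact_mod_cast hcert) hEx

/-! ### §2 X3♯(G-ord) ∩ `I₀*`: the same with Wuthrich's reducible upper half -/

/-- **X3♯(G-ord) ∩ `I₀*`, `p ≡ 1 (mod 4)`, `r_an = 0`: the LOWER half from the rational branch main
conjecture + certificate + `ExactLeadingTermAt W p`** (n1011-p18's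
`ClassX3Gord.missingLowerBoundAt_rankZero_of_cycLeadingTermDvd_of_exact`).
[cite: Delbourgo1998, Prop. 4 (p. 144), Main Conjecture (p. 151) (shapes)] -/
theorem ClassX3Gord.missingLowerBoundAt_rankZero_of_ratCharEq_of_unitCoeff_of_exact
    (hPal : Pal2012.thm32_sqrt_mul_realPeriodRat_twist_eq_of_prime_one_mod_four)
    (hGZK : rank_eq_analyticRank_of_analyticRank_le_one) (hmod : hasEntireLFunction_rat)
    (hmodD : nonempty_modularParametrizationData)
    (hX : ClassX3Gord W p) (he : semistabilityIndex W p = 2) (hp4 : p % 4 = 1)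
    (hr : W.analyticRank = 0) (hMC : ChiBranchRatCharEqAt W p)
    (hcert : ∀ (V : WeierstrassCurve ℚ) [V.IsElliptic] [V.IsGloballyMinimal] (C : VariableChange ℚ),
      GoodOrd V p → C • V.quadraticTwist (p : ℚ) = W →
      ∀ {N : ℕ} [NeZero N] (f : CuspForm (Gamma0 N) 2), IsNewformOf V f →
      ∀ ϖ : ℚ, (ϖ : ℝ) * V.realPeriodRat = plusPeriod f →
      ∃ n : ℕ, ‖PowerSeries.coeff n
        (PowerSeries.C (ϖ : ℚ_[p]) * padicLFunctionBranch f (unitRoot V p : ℚ_[p]) (p / 2))‖ = 1)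
    (hEx : ExactLeadingTermAt W p) : MissingLowerBoundAt W p := by
  have hp2 : p ≠ 2 := by omega
  obtain ⟨V, iV, iVm, C, hV, hC⟩ := hX.exists_goodOrd_pStar_twist_model W p hp2 he
  haveI : NeZero (V.conductorNorm ℤ) := ⟨(V.conductorNorm_pos_holds).ne'⟩
  obtain ⟨Dm⟩ := hmodD V
  obtain ⟨ϖ, -, hϖ, -⟩ := Dm.exists_rat_mul_realPeriodRat_eq_plusPeriod
  have hC' : C • V.quadraticTwist (p : ℚ) = W := by
    rw [pStar_eq_of_mod_four p (Or.inl hp4), if_pos hp4] at hC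
    exact hC
  exact ClassX3Gord.missingLowerBoundAt_rankZero_of_cycLeadingTermDvd_of_exact hGZK hmod hX hr
    (cycLeadingTermDvdAt_of_cycLowerLeadingTermAt
      (cycLowerLeadingTermAt_of_chiBranchRatCharEq_of_unitCoeff W p hPal hmod hp4 hX.addv V ⟨C, hC'⟩ hV
        Dm.isNewformOf ϖ hϖ hMC (hcert V C hV hC' Dm.f Dm.isNewformOf ϖ hϖ)))
    hEx

/-- **X3♯(G-ord) ∩ `I₀*`, `p ≡ 3 (mod 4)` (`p = 3` INCLUDED), `r_an = 0`: the LOWER half from the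
rational ODD branch main conjecture + certificate + `ExactLeadingTermAt W p`.**
[cite: Delbourgo1998, Prop. 4 (p. 144), Main Conjecture (p. 151) (shapes)] -/
theorem ClassX3Gord.missingLowerBoundAt_rankZero_of_ratCharEqOdd_of_unitCoeff_of_exact
    (hGZK : rank_eq_analyticRank_of_analyticRank_le_one) (hmod : hasEntireLFunction_rat)
    (hmodD : nonempty_modularParametrizationData)
    (hX : ClassX3Gord W p) (he : semistabilityIndex W p = 2) (hp4 : p % 4 = 3)
    (hr : W.analyticRank = 0) (hMC : ChiBranchRatCharEqOddAt W p)
    (hcert : ∀ (V : WeierstrassCurve ℚ) [V.IsElliptic] [V.IsGloballyMinimal] (C : VariableChange ℚ),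
      GoodOrd V p → C • V.quadraticTwist (-(p : ℚ)) = W →
      ∀ {N : ℕ} [NeZero N] (f : CuspForm (Gamma0 N) 2), IsNewformOf V f →
      ∀ ϖ : ℚ, (ϖ : ℝ) * V.imaginaryPeriodRat = minusPeriod f →
      ∃ n : ℕ, ‖PowerSeries.coeff n
        (PowerSeries.C (ϖ : ℚ_[p]) * padicLFunctionMinusBranch f (unitRoot V p : ℚ_[p]) (p / 2))‖ = 1)
    (hEx : ExactLeadingTermAt W p) : MissingLowerBoundAt W p := by
  have hp2 : p ≠ 2 := by omega
  obtain ⟨V, iV, iVm, C, hV, hC⟩ := hX.exists_goodOrd_pStar_twist_model W p hp2 he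
  haveI : NeZero (V.conductorNorm ℤ) := ⟨(V.conductorNorm_pos_holds).ne'⟩
  obtain ⟨Dm⟩ := hmodD V
  obtain ⟨ϖ, -, hϖ⟩ := exists_rat_mul_imaginaryPeriodRat_eq_minusPeriod Dm
  have hC' : C • V.quadraticTwist (-(p : ℚ)) = W := by
    rw [pStar_eq_of_mod_four p (Or.inr hp4), if_neg (by omega)] at hC
    exact hC
  exact ClassX3Gord.missingLowerBoundAt_rankZero_of_cycLeadingTermDvd_of_exact hGZK hmod hX hr
    (cycLeadingTermDvdAt_of_cycLowerLeadingTermAt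
      (cycLowerLeadingTermAt_of_chiBranchRatCharEqOdd_of_unitCoeff W p hmod hp4 hX.addv V C hC' hV
        Dm.isNewformOf ϖ hϖ hMC (hcert V C hV hC' Dm.f Dm.isNewformOf ϖ hϖ)))
    hEx

/-- **X3♯(G-ord) ∩ `I₀*`, `p ≡ 1 (mod 4)`, `r_an = 0`: `BSD(E,p)` from the rational branch main
conjecture + certificate + `ExactLeadingTermAt W p`, upper half WUTHRICH** (no image hypothesis).
Nothing booked. [cite: Wuthrich2014, Thm. 16 (p. 397)] [cite: Delbourgo1998, Prop. 4 (p. 144)] [cite: Miller2011LMS, Def. 1.1] -/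
theorem ClassX3Gord.bsdp_rankZero_of_ratCharEq_of_unitCoeff_of_exact_of_wuthrichHalf
    (hWu : Wuthrich2014.thm16_halfEigenCharIdeal_dvd_cyclotomicPrime)
    (hDel98 : Delbourgo1998.prop4_rankZero_pow_dvd_constantCoeff)
    (hPal : Pal2012.thm32_sqrt_mul_realPeriodRat_twist_eq_of_prime_one_mod_four)
    (hGZK : rank_eq_analyticRank_of_analyticRank_le_one) (hmod : hasEntireLFunction_rat)
    (hmodD : nonempty_modularParametrizationData)
    (hX : ClassX3Gord W p) (he : semistabilityIndex W p = 2) (hp4 : p % 4 = 1)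
    (hr : W.analyticRank = 0) (hMC : ChiBranchRatCharEqAt W p)
    (hcert : ∀ (V : WeierstrassCurve ℚ) [V.IsElliptic] [V.IsGloballyMinimal] (C : VariableChange ℚ),
      GoodOrd V p → C • V.quadraticTwist (p : ℚ) = W →
      ∀ {N : ℕ} [NeZero N] (f : CuspForm (Gamma0 N) 2), IsNewformOf V f →
      ∀ ϖ : ℚ, (ϖ : ℝ) * V.realPeriodRat = plusPeriod f →
      ∃ n : ℕ, ‖PowerSeries.coeff n
        (PowerSeries.C (ϖ : ℚ_[p]) * padicLFunctionBranch f (unitRoot V p : ℚ_[p]) (p / 2))‖ = 1)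
    (hEx : ExactLeadingTermAt W p) : BSDp W p :=
  bsdp_of_missingPPartAt W p hGZK (by rw [hr]; exact zero_le_one)
    (missingPPartAt_of_lower_of_upper W p
      (ClassX3Gord.missingLowerBoundAt_rankZero_of_ratCharEq_of_unitCoeff_of_exact hPal hGZK hmod hmodD
        hX he hp4 hr hMC hcert hEx)
      (ClassX3Gord.missingUpperBoundAt_rankZero_of_wuthrichHalf hWu hDel98 hGZK hmod hmodD (by omega) hX
        he hr))

/-- **X3♯(G-ord) ∩ `I₀*`, `p ≡ 3 (mod 4)` (`p = 3` INCLUDED), `r_an = 0`: `BSD(E,p)` from the rational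
ODD branch main conjecture + certificate + `ExactLeadingTermAt W p`, upper half Wuthrich.** Nothing
booked. [cite: Wuthrich2014, Thm. 16 (p. 397)] [cite: Delbourgo1998, Prop. 4 (p. 144)] [cite: Miller2011LMS, Def. 1.1] -/
theorem ClassX3Gord.bsdp_rankZero_of_ratCharEqOdd_of_unitCoeff_of_exact_of_wuthrichHalf
    (hWu : Wuthrich2014.thm16_halfEigenCharIdeal_dvd_cyclotomicPrime)
    (hDel98 : Delbourgo1998.prop4_rankZero_pow_dvd_constantCoeff)
    (hGZK : rank_eq_analyticRank_of_analyticRank_le_one) (hmod : hasEntireLFunction_rat)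
    (hmodD : nonempty_modularParametrizationData)
    (hX : ClassX3Gord W p) (he : semistabilityIndex W p = 2) (hp4 : p % 4 = 3)
    (hr : W.analyticRank = 0) (hMC : ChiBranchRatCharEqOddAt W p)
    (hcert : ∀ (V : WeierstrassCurve ℚ) [V.IsElliptic] [V.IsGloballyMinimal] (C : VariableChange ℚ),
      GoodOrd V p → C • V.quadraticTwist (-(p : ℚ)) = W →
      ∀ {N : ℕ} [NeZero N] (f : CuspForm (Gamma0 N) 2), IsNewformOf V f →
      ∀ ϖ : ℚ, (ϖ : ℝ) * V.imaginaryPeriodRat = minusPeriod f →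
      ∃ n : ℕ, ‖PowerSeries.coeff n
        (PowerSeries.C (ϖ : ℚ_[p]) * padicLFunctionMinusBranch f (unitRoot V p : ℚ_[p]) (p / 2))‖ = 1)
    (hEx : ExactLeadingTermAt W p) : BSDp W p :=
  bsdp_of_missingPPartAt W p hGZK (by rw [hr]; exact zero_le_one)
    (missingPPartAt_of_lower_of_upper W p
      (ClassX3Gord.missingLowerBoundAt_rankZero_of_ratCharEqOdd_of_unitCoeff_of_exact hGZK hmod hmodD
        hX he hp4 hr hMC hcert hEx)
      (ClassX3Gord.missingUpperBoundAt_rankZero_of_wuthrichHalf hWu hDel98 hGZK hmod hmodD (by omega) hX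
        he hr))

end Summit.BirchSwinnertonDyer.Rank1Residual.Additive

end
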